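import Summits.ValiantsHypothesis.ValiantsHypothesis.Theorems.FifoMatchingNNDivisionHardLocalizationFaceSpecies

/-!
# FifoMatching · NNDivisionHard — localization, part 9: §B5 cube calculus — genericity, lex-sign patterns, cube points, the two canonical scales

Theorems-grade port (bytes staged by val-idea-43 g6 for a port hand) of §B5 of the crux workfile `Cruxes/NNDivisionHard/Symmetry43.lean`
REV 3 @6f612840a212 (sha16 feaccae65024a9a0, 1343 l.; val-idea-43 g6, crux `stmt-ValiantsHypothesis-21181` `FifoMatching.NNDivisionHard`;
critic of record val-idea-crit-9 g3 V#106: «STICK-OUT CUBES ∈ Face Quiet: CHECKED HARD, PAPER PASS; classification = INSTANCE FAMILY of S43-2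
`Face Quiet`, not a new class; GO for rev 3 §B5 → Localization port») — statements and proofs VERBATIM, namespace
`…Theorems.FifoMatching.Localization` (continues parts 1–8; imports part 8 ✓/⧗ `…LocalizationFaceSpecies` for `stableFun`, `stable_free`,
`face_of_twoScale`, `faceQuiet_of_twoScaleTop`).

Part 9 = the CALCULUS: `exists_dotProduct_ne_zero` (finitely many nonzero vectors have a common non-orthogonal vector), the LEX-SIGN PATTERN of a
pair of coefficient vectors (`IsLexPattern`, termwise / summed domination and uniqueness `lexPattern_sum_eq`), CUBE POINTS `q₀ + Σ_t bit ε_t • g_t`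
over any finite index type (`cubePoint`, `IsCubeList` full lists, `IsVertexPattern` / `IsZonoList` vertex-complete zonotope lists — (s1) of V#106),
and the two CANONICAL SCALES for a coordinate injection `ι`: the diagonal PINS off `ι` (`pinOff ι = −Σ_{k∉ι} E_kk`: valid bound `0`, free on `ι`,
tight set `{b ⊆ ι}` — `pinOff_corVec_le / _free / _tight`) and a GENERIC TILT supported outside `ι × ι`, which vanishes on the tight `corVec`s
(`pinOff_outside`, `exists_generic_outside`).  The membership theorems are part 10.

Honest label: helper calculus for instance theorems of the TOP cone; NOT progress on `C′ = ExactPencilLaw` nor on `CoreLawOrb`; 21181 OPEN;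
VP ≠ VNP NOT proved.
-/

set_option linter.unusedVariables false
set_option linter.unusedSectionVars false
set_option linter.dupNamespace false

namespace Summit.ValiantsHypothesis.ValiantsHypothesis.Theorems.FifoMatching.Localization

open Matrix Finset
open scoped Pointwise
open Literature.Barriers.PneNP (HasEFOfSize)
open Literature.Combinatorics.Optimization (corPolytopeGraph corVec)

/-! ### §B5 genericity -/

/-- GENERICITY: finitely many nonzero vectors have a common non-orthogonal vector. -/
theorem exists_dotProduct_ne_zero {α τ : Type*} [Fintype α] [DecidableEq α] [DecidableEq τ] (s : Finset τ) (G : τ → α → ℝ)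
    (hG : ∀ t ∈ s, G t ≠ 0) : ∃ v : α → ℝ, ∀ t ∈ s, v ⬝ᵥ G t ≠ 0 := by
  classical
  induction s using Finset.induction_on with
  | empty => exact ⟨0, fun t ht => absurd ht (Finset.notMem_empty t)⟩
  | insert a s ha ih =>
    obtain ⟨v, hv⟩ := ih fun t ht => hG t (Finset.mem_insert_of_mem ht)
    by_cases hva : v ⬝ᵥ G a ≠ 0
    · refine ⟨v, fun t ht => ?_⟩
      rcases Finset.mem_insert.mp ht with rfl | ht
      · exact hva
      · exact hv t ht
    · replace hva : v ⬝ᵥ G a = 0 := not_not.mp hva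
      have hGa : G a ≠ 0 := hG a (Finset.mem_insert_self a s)
      obtain ⟨x, hx⟩ : ∃ x, G a x ≠ 0 := by
        by_contra hcon
        exact hGa (funext fun x => not_not.mp (not_exists.mp hcon x))
      obtain ⟨δ, hδ⟩ := Infinite.exists_notMem_finset (insert (0 : ℝ) (s.image fun t => -(v ⬝ᵥ G t) / G t x))
      have hδ0 : δ ≠ 0 := fun h0 => hδ (h0 ▸ Finset.mem_insert_self _ _)
      refine ⟨v + δ • Pi.single x 1, fun t ht => ?_⟩
      have hval : (v + δ • Pi.single x (1 : ℝ)) ⬝ᵥ G t = v ⬝ᵥ G t + δ * G t x := by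
        rw [add_dotProduct, smul_dotProduct, single_dotProduct, one_mul, smul_eq_mul]
      rw [hval]
      rcases Finset.mem_insert.mp ht with rfl | ht
      · rw [hva, zero_add]
        exact mul_ne_zero hδ0 hx
      · intro hzero
        by_cases hGt : G t x = 0
        · rw [hGt, mul_zero, add_zero] at hzero
          exact hv t ht hzero
        · refine hδ (Finset.mem_insert_of_mem (Finset.mem_image.mpr ⟨t, ht, ?_⟩))
          rw [div_eq_iff hGt]
          linarith

/-! ### lex-sign patterns -/

/-- the real bit of a Boolean. -/
def bit (e : Bool) : ℝ := if e then 1 else 0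

/-- `bit true = 1`. [folklore] -/
@[simp] theorem bit_true : bit true = 1 := rfl
/-- `bit false = 0`. [folklore] -/
@[simp] theorem bit_false : bit false = 0 := rfl

/-- termwise optimality of the bit `[0 < a]`: `(bit e − bit [0 < a]) · a ≤ 0`. -/
theorem bit_term_nonpos (a : ℝ) (e : Bool) : (bit e - bit (decide (0 < a))) * a ≤ 0 := by
  by_cases h : 0 < a
  · rw [decide_eq_true h]
    cases e
    · rw [bit_false, bit_true]; linarith
    · rw [bit_true, sub_self, zero_mul]
  · rw [decide_eq_false h]
    have h' : a ≤ 0 := not_lt.mp h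
    cases e
    · rw [bit_false, sub_self, zero_mul]
    · rw [bit_true, bit_false]; linarith

/-- … with equality only at the optimal bit when `a ≠ 0`. -/
theorem bit_term_eq_zero {a : ℝ} (ha : a ≠ 0) {e : Bool} (h0 : (bit e - bit (decide (0 < a))) * a = 0) :
    e = decide (0 < a) := by
  have h1 : bit e - bit (decide (0 < a)) = 0 := by
    rcases mul_eq_zero.mp h0 with h | h
    · exact h
    · exact absurd h ha
  by_cases h : 0 < a
  · rw [decide_eq_true h] at h1 ⊢
    cases e
    · rw [bit_false, bit_true] at h1; norm_num at h1
    · rfl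
  · rw [decide_eq_false h] at h1 ⊢
    cases e
    · rfl
    · rw [bit_true, bit_false] at h1; norm_num at h1

/-- the LEX-SIGN PATTERN of a pair of coefficient vectors `(A, B)` (the second one nowhere zero where the first vanishes):
`εs t = [0 < A t]` if `A t ≠ 0`, else `[0 < B t]`. -/
def IsLexPattern {τ : Type*} (A B : τ → ℝ) (εs : τ → Bool) : Prop :=
  ∀ t, (A t ≠ 0 ∧ εs t = decide (0 < A t)) ∨ (A t = 0 ∧ B t ≠ 0 ∧ εs t = decide (0 < B t))

/-- a lex-sign pattern exists as soon as every index is seen by `A` or `B`. -/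
theorem exists_lexPattern {τ : Type*} (A B : τ → ℝ) (hAB : ∀ t, A t ≠ 0 ∨ B t ≠ 0) : ∃ εs, IsLexPattern A B εs := by
  classical
  refine ⟨fun t => if A t ≠ 0 then decide (0 < A t) else decide (0 < B t), fun t => ?_⟩
  by_cases hA : A t ≠ 0
  · exact Or.inl ⟨hA, by dsimp only; rw [if_pos hA]⟩
  · rcases hAB t with h | h
    · exact absurd h hA
    · exact Or.inr ⟨not_not.mp hA, h, by dsimp only; rw [if_neg hA]⟩

/-- termwise: every pattern is `A`-dominated by the lex pattern, … -/
theorem lexPattern_term_fst {τ : Type*} {A B : τ → ℝ} {εs : τ → Bool} (hεs : IsLexPattern A B εs) (ε : τ → Bool)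
    (t : τ) : (bit (ε t) - bit (εs t)) * A t ≤ 0 := by
  rcases hεs t with ⟨_, h⟩ | ⟨hA, -, -⟩
  · rw [h]; exact bit_term_nonpos _ _
  · rw [hA, mul_zero]

/-- … an `A`-tie is `B`-dominated, … -/
theorem lexPattern_term_snd {τ : Type*} {A B : τ → ℝ} {εs : τ → Bool} (hεs : IsLexPattern A B εs) (ε : τ → Bool)
    (t : τ) (h0 : (bit (ε t) - bit (εs t)) * A t = 0) : (bit (ε t) - bit (εs t)) * B t ≤ 0 := by
  rcases hεs t with ⟨hA, h⟩ | ⟨_, _, h⟩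
  · rw [h] at h0 ⊢
    rw [bit_term_eq_zero hA h0, sub_self, zero_mul]
  · rw [h]; exact bit_term_nonpos _ _

/-- … and a double tie is the lex bit. -/
theorem lexPattern_term_eq {τ : Type*} {A B : τ → ℝ} {εs : τ → Bool} (hεs : IsLexPattern A B εs) (ε : τ → Bool)
    (t : τ) (h0 : (bit (ε t) - bit (εs t)) * A t = 0) (h1 : (bit (ε t) - bit (εs t)) * B t = 0) : ε t = εs t := by
  rcases hεs t with ⟨hA, h⟩ | ⟨_, hB, h⟩
  · rw [h] at h0 ⊢; exact bit_term_eq_zero hA h0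
  · rw [h] at h1 ⊢; exact bit_term_eq_zero hB h1

/-- summed: `A`-domination, … -/
theorem lexPattern_sum_fst {τ : Type*} [Fintype τ] {A B : τ → ℝ} {εs : τ → Bool} (hεs : IsLexPattern A B εs)
    (ε : τ → Bool) : ∑ t, (bit (ε t) - bit (εs t)) * A t ≤ 0 :=
  Finset.sum_nonpos fun t _ => lexPattern_term_fst hεs ε t

/-- … `B`-domination on an `A`-tie, … -/
theorem lexPattern_sum_snd {τ : Type*} [Fintype τ] {A B : τ → ℝ} {εs : τ → Bool} (hεs : IsLexPattern A B εs)
    (ε : τ → Bool) (h0 : ∑ t, (bit (ε t) - bit (εs t)) * A t = 0) : ∑ t, (bit (ε t) - bit (εs t)) * B t ≤ 0 := by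
  have hz := (Finset.sum_eq_zero_iff_of_nonpos fun t _ => lexPattern_term_fst hεs ε t).mp h0
  exact Finset.sum_nonpos fun t ht => lexPattern_term_snd hεs ε t (hz t ht)

/-- … and UNIQUENESS of the lex-optimal pattern on a double tie. -/
theorem lexPattern_sum_eq {τ : Type*} [Fintype τ] {A B : τ → ℝ} {εs : τ → Bool} (hεs : IsLexPattern A B εs)
    (ε : τ → Bool) (h0 : ∑ t, (bit (ε t) - bit (εs t)) * A t = 0) (h1 : ∑ t, (bit (ε t) - bit (εs t)) * B t = 0) :
    ε = εs := by
  have hzA := (Finset.sum_eq_zero_iff_of_nonpos fun t _ => lexPattern_term_fst hεs ε t).mp h0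
  have hzB := (Finset.sum_eq_zero_iff_of_nonpos fun t ht => lexPattern_term_snd hεs ε t (hzA t ht)).mp h1
  exact funext fun t => lexPattern_term_eq hεs ε t (hzA t (Finset.mem_univ t)) (hzB t (Finset.mem_univ t))

/-! ### cube points and cube lists -/

/-- the CUBE POINT of pattern `ε`: `q₀ + Σ_t bit(ε_t) • g_t` (generators indexed by any finite type `τ`; for `τ = Fin M` this is
`FaceBlind.subsetSum g q₀ {t | ε t}` of ✓ `…Theorems.FifoMatchingNNDivisionHardFaceBlind` — not imported: the termwise / `Sum`-split calculus
below wants Boolean patterns over an arbitrary finite index type). -/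
def cubePoint {h : ℕ} {τ : Type*} [Fintype τ] (q₀ : Fin h × Fin h → ℝ) (g : τ → (Fin h × Fin h → ℝ)) (ε : τ → Bool) :
    Fin h × Fin h → ℝ :=
  q₀ + ∑ t, bit (ε t) • g t

/-- FULL CUBE LISTS: the family lists exactly the cube points of `(q₀, g)` (every pattern occurs; repeats allowed). -/
def IsCubeList {h K : ℕ} {τ : Type*} [Fintype τ] (q : Fam h K) (q₀ : Fin h × Fin h → ℝ) (g : τ → (Fin h × Fin h → ℝ)) :
    Prop :=
  (∀ j, ∃ ε, q j = cubePoint q₀ g ε) ∧ (∀ ε, ∃ j, q j = cubePoint q₀ g ε)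

/-- VERTEX PATTERNS of a generator system: the lex-sign patterns of pairs of functionals that see every generator
(paper remark: these are exactly the patterns of the vertices of the zonotope `Σ_t [0, g_t]`). -/
def IsVertexPattern {h : ℕ} {τ : Type*} (g : τ → (Fin h × Fin h → ℝ)) (ε : τ → Bool) : Prop :=
  ∃ u₁ u₂ : Fin h × Fin h → ℝ, IsLexPattern (fun t => u₁ ⬝ᵥ g t) (fun t => u₂ ⬝ᵥ g t) ε

/-- VERTEX-COMPLETE ZONOTOPE LISTS ((s1) of V#106): every listed point is a cube point and every vertex pattern is listed. -/
def IsZonoList {h K : ℕ} {τ : Type*} [Fintype τ] (q : Fam h K) (q₀ : Fin h × Fin h → ℝ) (g : τ → (Fin h × Fin h → ℝ)) :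
    Prop :=
  (∀ j, ∃ ε, q j = cubePoint q₀ g ε) ∧ (∀ ε, IsVertexPattern g ε → ∃ j, q j = cubePoint q₀ g ε)

/-- a full cube list is a vertex-complete zonotope list. -/
theorem IsCubeList.isZonoList {h K : ℕ} {τ : Type*} [Fintype τ] {q : Fam h K} {q₀ : Fin h × Fin h → ℝ}
    {g : τ → (Fin h × Fin h → ℝ)} (hq : IsCubeList q q₀ g) : IsZonoList q q₀ g :=
  ⟨hq.1, fun ε _ => hq.2 ε⟩

/-- a functional on a cube point: `w ⬝ (q₀ + Σ bit ε_t • g_t) = w ⬝ q₀ + Σ bit ε_t · (w ⬝ g_t)`. -/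
theorem dotProduct_cubePoint {h : ℕ} {τ : Type*} [Fintype τ] (w q₀ : Fin h × Fin h → ℝ) (g : τ → (Fin h × Fin h → ℝ))
    (ε : τ → Bool) : w ⬝ᵥ cubePoint q₀ g ε = w ⬝ᵥ q₀ + ∑ t, bit (ε t) * (w ⬝ᵥ g t) := by
  unfold cubePoint
  rw [dotProduct_add, dotProduct_sum]
  exact congrArg _ (Finset.sum_congr rfl fun t _ => by rw [dotProduct_smul, smul_eq_mul])

/-- difference of a functional at two cube points. -/
theorem dotProduct_cubePoint_sub {h : ℕ} {τ : Type*} [Fintype τ] (w q₀ : Fin h × Fin h → ℝ) (g : τ → (Fin h × Fin h → ℝ))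
    (ε ε' : τ → Bool) :
    w ⬝ᵥ cubePoint q₀ g ε - w ⬝ᵥ cubePoint q₀ g ε' = ∑ t, (bit (ε t) - bit (ε' t)) * (w ⬝ᵥ g t) := by
  rw [dotProduct_cubePoint, dotProduct_cubePoint, add_sub_add_left_eq_sub, ← Finset.sum_sub_distrib]
  exact Finset.sum_congr rfl fun t _ => by ring

/-- splitting the generators: the `(δ, εo)`-point of `gi ⊕ go` is the `δ`-point of `gi` over the `εo`-point of `go`. -/
theorem cubePoint_sum_elim {h : ℕ} {τi τo : Type*} [Fintype τi] [Fintype τo] (q₀ : Fin h × Fin h → ℝ)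
    (gi : τi → (Fin h × Fin h → ℝ)) (go : τo → (Fin h × Fin h → ℝ)) (δ : τi → Bool) (εo : τo → Bool) :
    cubePoint q₀ (Sum.elim gi go) (Sum.elim δ εo) = cubePoint (cubePoint q₀ go εo) gi δ := by
  unfold cubePoint
  rw [Fintype.sum_sum_type]
  simp only [Sum.elim_inl, Sum.elim_inr]
  abel

/-- reads commute with cube points. -/
theorem delRead_cubePoint {h ℓ : ℕ} {τ : Type*} [Fintype τ] (ι : Fin ℓ ↪ Fin h) (q₀ : Fin h × Fin h → ℝ)
    (g : τ → (Fin h × Fin h → ℝ)) (ε : τ → Bool) :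
    delRead ι (cubePoint q₀ g ε) = cubePoint (delRead ι q₀) (fun t => delRead ι (g t)) ε := by
  unfold cubePoint
  rw [map_add, map_sum]
  simp only [map_smul]

/-! ### the two scales: pins off `ι`, generic tilt outside `ι × ι` -/

/-- «position `p` is OUTSIDE `ι × ι`». -/
def Outside {h ℓ : ℕ} (ι : Fin ℓ ↪ Fin h) (p : Fin h × Fin h) : Prop := (∀ a, ι a ≠ p.1) ∨ (∀ a, ι a ≠ p.2)

/-- the canonical first scale for `ι`: the diagonal PINS off `ι`, `pinOff ι = −Σ_{k ∉ ι} E_kk`. -/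
noncomputable def pinOff {h ℓ : ℕ} (ι : Fin ℓ ↪ Fin h) : Fin h × Fin h → ℝ :=
  stableFun (Finset.univ.filter fun p : Fin h × Fin h => p.1 = p.2 ∧ ∀ a, ι a ≠ p.1)

/-- `pinOff ι` is VALID with bound `0`, … -/
theorem pinOff_corVec_le {h ℓ : ℕ} (ι : Fin ℓ ↪ Fin h) (b : Fin h → Bool) :
    pinOff ι ⬝ᵥ corVec (⊤ : SimpleGraph (Fin h)) b ≤ 0 :=
  stableFun_corVec_le _ b

/-- … FREE on `ι`, … -/
theorem pinOff_free {h ℓ : ℕ} (ι : Fin ℓ ↪ Fin h) (c : Fin ℓ → Bool) :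
    ∃ b : Fin h → Bool, pinOff ι ⬝ᵥ corVec (⊤ : SimpleGraph (Fin h)) b = 0 ∧ b ∘ ι = c :=
  stable_free _ ι (fun p hp => Or.inl (Finset.mem_filter.mp hp).2.2) c

/-- … TIGHT exactly on the `b` vanishing off `ι`, … -/
theorem pinOff_tight {h ℓ : ℕ} (ι : Fin ℓ ↪ Fin h) (b : Fin h → Bool)
    (hb : pinOff ι ⬝ᵥ corVec (⊤ : SimpleGraph (Fin h)) b = 0) (k : Fin h) (hk : ∀ a, ι a ≠ k) : b k = false := by
  classical
  unfold pinOff at hb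
  rw [stableFun_dotProduct, neg_eq_zero] at hb
  have hkk : corVec (⊤ : SimpleGraph (Fin h)) b (k, k) = 0 :=
    (Finset.sum_eq_zero_iff_of_nonneg fun p _ => corVec_top_nonneg b p).mp hb (k, k)
      (Finset.mem_filter.mpr ⟨Finset.mem_univ _, rfl, hk⟩)
  rw [corVec_top_apply] at hkk
  cases hbk : b k
  · rfl
  · rw [hbk, Bool.and_self, if_pos rfl] at hkk
    exact absurd hkk one_ne_zero

/-- … so a second scale supported OUTSIDE `ι × ι` VANISHES on the tight set, … -/
theorem pinOff_outside {h ℓ : ℕ} (ι : Fin ℓ ↪ Fin h) (v : Fin h × Fin h → ℝ) (hv : ∀ p, ¬ Outside ι p → v p = 0)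
    (b : Fin h → Bool) (hb : pinOff ι ⬝ᵥ corVec (⊤ : SimpleGraph (Fin h)) b = 0) :
    v ⬝ᵥ corVec (⊤ : SimpleGraph (Fin h)) b = 0 := by
  unfold dotProduct
  refine Finset.sum_eq_zero fun p _ => ?_
  by_cases hp : Outside ι p
  · rcases hp with h1 | h1
    · rw [show p = (p.1, p.2) from rfl, corVec_top_eq_zero_of_fst b p.2 (pinOff_tight ι b hb p.1 h1), mul_zero]
    · rw [show p = (p.1, p.2) from rfl, corVec_top_eq_zero_of_snd b p.1 (pinOff_tight ι b hb p.2 h1), mul_zero]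
  · rw [hv p hp, zero_mul]

/-- … and the first scale does not see vectors vanishing outside `ι × ι`. -/
theorem pinOff_dotProduct_eq_zero {h ℓ : ℕ} (ι : Fin ℓ ↪ Fin h) (y : Fin h × Fin h → ℝ)
    (hy : ∀ p, Outside ι p → y p = 0) : pinOff ι ⬝ᵥ y = 0 := by
  unfold pinOff
  rw [stableFun_dotProduct, neg_eq_zero]
  exact Finset.sum_eq_zero fun p hp => hy p (Or.inl (Finset.mem_filter.mp hp).2.2)

/-- a GENERIC TILT outside `ι × ι`: supported outside, non-orthogonal to every member of a finite family of vectors that do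
not vanish outside. -/
theorem exists_generic_outside {h ℓ : ℕ} {τ : Type*} [DecidableEq τ] (ι : Fin ℓ ↪ Fin h) (s : Finset τ)
    (G : τ → (Fin h × Fin h → ℝ)) (hG : ∀ t ∈ s, ∃ p, Outside ι p ∧ G t p ≠ 0) :
    ∃ v : Fin h × Fin h → ℝ, (∀ p, ¬ Outside ι p → v p = 0) ∧ ∀ t ∈ s, v ⬝ᵥ G t ≠ 0 := by
  classical
  obtain ⟨v₁, hv₁⟩ := exists_dotProduct_ne_zero s (fun t p => if Outside ι p then G t p else 0) fun t ht hzero => by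
    obtain ⟨p, hp, hg⟩ := hG t ht
    have h1 := congr_fun hzero p
    rw [if_pos hp] at h1
    exact hg h1
  refine ⟨fun p => if Outside ι p then v₁ p else 0, fun p hp => if_neg hp, fun t ht => ?_⟩
  have h1 : (fun p => if Outside ι p then v₁ p else 0) ⬝ᵥ G t = v₁ ⬝ᵥ fun p => if Outside ι p then G t p else 0 := by
    unfold dotProduct
    exact Finset.sum_congr rfl fun p _ => by dsimp only; split_ifs <;> ring
  rw [h1]
  exact hv₁ t ht

end Summit.ValiantsHypothesis.ValiantsHypothesis.Theorems.FifoMatching.Localization
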